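import Summits.AtomisticToContinuum.BoseEinsteinCondensation.Theorems.BECStronglyRayleighLatticeToPeriodicBridgePairFromSingle
import Summits.AtomisticToContinuum.BoseEinsteinCondensation.Theorems.BECStronglyRayleighLatticeToPeriodicBridgeFewBodyCondensation

/-!
# Route `BECStronglyRayleigh`, crux `LatticeToPeriodicBridge` (stmt-AtomisticToContinuum-9674),
# line `coarse-cell-lorentzian` — the two-sided sandwich, final form: S45 from a PLAIN condensate floor

Helper file of the crux line `coarse-cell-lorentzian`, landed `--supports stmt-AtomisticToContinuum-9674`. It assembles
`…PairFromSingle.lean` (`stub_pairKernelRowFlatness_of_condensateFloor`: a uniform floor `n₀ ≥ max(c, 2/(N+1))·N` for the real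
`≥ 0` near-minimisers gives the registered residual stub S45) with `…FewBodyCondensation.lean` (`fewBody_condensed`: few bosons
on a large torus are `2/3`-condensed) into the final DOWN direction of the sandwich:

* `stub_pairKernelRowFlatness_of_plainCondensateFloor` : if for every repulsive finite-range `v` there are `c, L₁, ρ_d > 0` such
  that on every torus of side `L ≥ L₁` with `N = N'+2 ≤ ρ_d L³` bosons some slack `δ > 0` makes every REAL NON-NEGATIVE
  `δ`-near-minimiser satisfy `n₀ ≥ c·N` — torus BEC of the positive near-minimisers, uniform on the dilute tori, NOTHING ELSE —
  then `Sig.stub_pairKernelRowFlatness` holds (`𝕄 = 2/c²`). The few-body near-minimisers (`N + 1 < 2/c`) are handled by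
  `fewBody_condensed` with the slack `δ = L⁻³`, the others by the hypothesis.

With lead-0's UP direction (`periodicBEC_of`: S45 ∧ S1–S3, S6 ∧ 9467 ∧ 14006 ⟹ `PeriodicBEC`) this is the kernel-checked statement
that the line `coarse-cell-lorentzian` is a DICTIONARY: its one open registered stub is equivalent, up to constants and the
uniform-vs-eventual form of the quantifiers, to torus BEC of the real `≥ 0` near-minimisers — the consequent of the crux.
-/

noncomputable section

open MeasureTheory Filter Metric Set
open scoped ENNReal Topology NNReal Real

namespace Summit.AtomisticToContinuum.BoseEinsteinCondensation.Cruxes.LatticeToPeriodicBridge.CoarseCellLorentzian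

open Literature.MathematicalPhysics.QuantumManyBody.BoseGas

/-- **Row flatness from a plain condensate floor** (the sandwich, final DOWN form): uniform torus BEC of the real `≥ 0`
near-minimisers on the dilute tori implies the registered residual stub `Sig.stub_pairKernelRowFlatness` of the line.
Proof: `N₀ = ⌈2/c⌉₊`; for `N'+3 ≥ 2/c` the hypothesis gives the floor `c = max(c, 2/(N'+3))`, for `N'+3 < 2/c` (so
`N'+2 ≤ N₀` and `c < 2/3`) `fewBody_condensed` gives `n₀ ≥ (2/3)N ≥ max(c, 2/(N'+3))·N` at slack `L⁻³`; then
`stub_pairKernelRowFlatness_of_condensateFloor`. [folklore] -/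
theorem stub_pairKernelRowFlatness_of_plainCondensateFloor
    (h : ∀ v : ℝ → ℝ≥0∞, IsRepulsiveFiniteRange v → ∃ c : ℝ, 0 < c ∧ ∃ L₁ : ℝ, 0 < L₁ ∧ ∃ ρd : ℝ, 0 < ρd ∧
      ∀ L : ℝ, L₁ ≤ L → ∀ N' : ℕ, ((N' : ℝ) + 2) ≤ ρd * L ^ 3 →
        ∃ δ : ℝ≥0∞, 0 < δ ∧ ∀ Ψ : PeriodicTrialState (N' + 2) L,
          (∀ X, 0 ≤ (Ψ.ψ X).re ∧ (Ψ.ψ X).im = 0) →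
          periodicEnergy v Ψ ≤ periodicGroundStateEnergy v (N' + 2) L + δ →
            ENNReal.ofReal (c * ((N' : ℝ) + 2)) ≤ condensateOccupation (N' + 2) L Ψ.ψ) :
    Sig.stub_pairKernelRowFlatness := by
  refine stub_pairKernelRowFlatness_of_condensateFloor fun v hv => ?_
  obtain ⟨c, hc, L₁, hL₁, ρd, hρd, hfl⟩ := h v hv
  set N₀ : ℕ := ⌈2 / c⌉₊ with hN₀
  obtain ⟨L₂, hL₂, hfew⟩ := FewBody.fewBody_condensed v hv N₀
  refine ⟨c, hc, max L₁ L₂, lt_max_of_lt_left hL₁, ρd, hρd, fun L hL N' hN' => ?_⟩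
  have hL₁L : L₁ ≤ L := (le_max_left _ _).trans hL
  have hL₂L : L₂ ≤ L := (le_max_right _ _).trans hL
  have hLpos : 0 < L := hL₁.trans_le hL₁L
  have hN3 : (0 : ℝ) < (N' : ℝ) + 3 := by positivity
  by_cases hcase : 2 / c ≤ (N' : ℝ) + 3
  · -- many-body: the hypothesis' own floor, `max(c, 2/(N'+3)) = c`
    obtain ⟨δ, hδ, hΨ⟩ := hfl L hL₁L N' hN'
    refine ⟨δ, hδ, fun Ψ hpos hE => ?_⟩
    have hmax : max c (2 / ((N' : ℝ) + 3)) = c := by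
      refine max_eq_left ?_
      rw [div_le_iff₀ hN3]
      rw [div_le_iff₀ hc] at hcase
      linarith
    rw [hmax]
    exact hΨ Ψ hpos hE
  · -- few-body: `N'+2 ≤ N₀`, `c < 2/3`, slack `L⁻³`, floor `2/3 ≥ max(c, 2/(N'+3))`
    push Not at hcase
    have hN'N₀ : N' + 2 ≤ N₀ := by
      have h1 : ((N' : ℝ) + 3) < (N₀ : ℝ) + 1 :=
        hcase.trans_le ((Nat.le_ceil (2 / c)).trans (by rw [hN₀]; linarith))
      have h2 : (N' : ℝ) + 2 < N₀ := by linarith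
      have h3 : ((N' + 2 : ℕ) : ℝ) < N₀ := by push_cast; exact h2
      exact_mod_cast h3.le
    have hc23 : c < 2 / 3 := by
      -- `3 ≤ N'+3 < 2/c`
      have h3 : (3 : ℝ) < 2 / c := lt_of_le_of_lt (by linarith [(Nat.cast_nonneg N' : (0 : ℝ) ≤ N')]) hcase
      rw [lt_div_iff₀ hc] at h3
      rw [lt_div_iff₀ (by norm_num : (0 : ℝ) < 3)]
      linarith
    refine ⟨ENNReal.ofReal (1 / L ^ 3), by rw [ENNReal.ofReal_pos]; positivity, fun Ψ _hpos hE => ?_⟩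
    have hfb := hfew L hL₂L N' hN'N₀ Ψ hE
    refine le_trans (ENNReal.ofReal_le_ofReal ?_) hfb
    have hN2 : (0 : ℝ) ≤ (N' : ℝ) + 2 := by positivity
    refine mul_le_mul_of_nonneg_right (max_le hc23.le ?_) hN2
    rw [div_le_div_iff₀ hN3 (by norm_num)]
    linarith [(Nat.cast_nonneg N' : (0 : ℝ) ≤ N')]

/-- **Registered form** (sub-goal `rowFlatnessSandwich_plainFloor` of the crux item, signature verbatim, fully qualified): a plain
uniform condensate floor for the real `≥ 0` near-minimisers implies the registered stub `Sig.stub_pairKernelRowFlatness`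
(= `stub_pairKernelRowFlatness_of_plainCondensateFloor`). [folklore] -/
theorem rowFlatnessSandwich_plainFloor : (∀ v : ℝ → ENNReal, Literature.MathematicalPhysics.QuantumManyBody.BoseGas.IsRepulsiveFiniteRange v → ∃ c : ℝ, 0 < c ∧ ∃ L₁ : ℝ, 0 < L₁ ∧ ∃ ρd : ℝ, 0 < ρd ∧ ∀ L : ℝ, L₁ ≤ L → ∀ N' : ℕ, ((N' : ℝ) + 2) ≤ ρd * L ^ 3 → ∃ δ : ENNReal, 0 < δ ∧ ∀ Ψ : Literature.MathematicalPhysics.QuantumManyBody.BoseGas.PeriodicTrialState (N' + 2) L, (∀ X, 0 ≤ (Ψ.ψ X).re ∧ (Ψ.ψ X).im = 0) → Literature.MathematicalPhysics.QuantumManyBody.BoseGas.periodicEnergy v Ψ ≤ Literature.MathematicalPhysics.QuantumManyBody.BoseGas.periodicGroundStateEnergy v (N' + 2) L + δ → ENNReal.ofReal (c * ((N' : ℝ) + 2)) ≤ Literature.MathematicalPhysics.QuantumManyBody.BoseGas.condensateOccupation (N' + 2) L Ψ.ψ) → Sig.stub_pairKernelRowFlatness :=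
  fun h => stub_pairKernelRowFlatness_of_plainCondensateFloor h

end Summit.AtomisticToContinuum.BoseEinsteinCondensation.Cruxes.LatticeToPeriodicBridge.CoarseCellLorentzian

end
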